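import Summits.BirchSwinnertonDyer.BirchSwinnertonDyer.Theses.ByReductionTypeAtTwo
import Summits.BirchSwinnertonDyer.BirchSwinnertonDyer.Theses.TwoAdicConverse
import Summits.BirchSwinnertonDyer.BirchSwinnertonDyer.Theorems.ByReductionTypeAtTwoOrdMissingLowerBoundAtTwoOfChildren

/-! # crux-triage r1 seat 1, GEN 17 probe — crux 203 on the READY route (K4 rev 29, commit 09607c665bae, 2026-08-28T23:11Z)

(Q17) Since GEN 16 the route `ByReductionTypeAtTwo` went rev 26 → 29 (staffable-fix v3: asides 20090 `AsideAbbesUllmoManinAtTwo`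
(dedup-attached), 23771 `AsideStevensOptimalGamma1AtTwo` (rev 27), B7 restated 23761 → 23780 (rev 28), 23781
`AsideKatoMuPartAtTwoOfTowerGap` (rev 29)) and is now READY YES / staffable YES (0 unproved cone deps).  This file re-certifies,
from the rev-29 TREE decls only, what crux 203 `OrdMissingLowerBoundAtTwo` (stmt-19577) is open on:
* `asideT2_iff`, `asideAU_iff` — the two new/attached asides ARE the print bundle's T2 / AU conjuncts (`Iff.rfl`);
* `bundle_iff_items`, `bundle_of_items` — the support child stmt-23764 `OrdMLBPrintBundleAtTwo` is, definitionally,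
  item 19149 ∧ (item 19567).1 ∧ aside 20090 ∧ aside 23771;
* `child_iff_S3` — the crux child is S3's stmt-19556 verbatim (unchanged by revs 27–29);
* `glue_landed` — the glue item stmt-23765 is the LANDED tree theorem p676269 (by name; not re-proved here);
* `crux203_of_items` — 19577 from K4's own items {19149, 19567, 20090, 23771} and S3's 19556, all BY NAME.
Kernel facts only.  BSD is not proved; stmt-19577 is NOT closed by this file (every input is a hypothesis; 19556 is research-open,
19149/19567/20090/23771 are print by name).  Not a landing (nothing here is a `¬`-refutation or a negative lemma). -/

set_option linter.dupNamespace false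

namespace Summit.BirchSwinnertonDyer.BirchSwinnertonDyer.Cruxes.OrdMissingLowerBoundAtTwo.TriageR1Seat1.Rev29Ready

open Summit.BirchSwinnertonDyer.BirchSwinnertonDyer
open Summit.BirchSwinnertonDyer.BirchSwinnertonDyer.Theses.ByReductionTypeAtTwo

/-- rev-27 aside stmt-23771 IS the bundle's T2 conjunct. -/
theorem asideT2_iff : AsideStevensOptimalGamma1AtTwo ↔
    Literature.NumberTheory.EllipticCurves.ModularForms.exists_optimal_gamma1ParametrizationData := Iff.rfl

/-- aside stmt-20090 IS the bundle's AU conjunct. -/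
theorem asideAU_iff : AsideAbbesUllmoManinAtTwo ↔
    Literature.NumberTheory.EllipticCurves.ModularForms.abbesUllmo_not_dvd_maninConstant_of_not_dvd_level := Iff.rfl

/-- the print bundle stmt-23764 = 19149 ∧ (19567).1 ∧ 20090 ∧ 23771, definitionally. -/
theorem bundle_iff_items : OrdMLBPrintBundleAtTwo ↔
    (OrdPublishedInputsAtTwo ∧ WeierstrassCurve.bsdRHS_eq_of_isIsogenous ∧ AsideAbbesUllmoManinAtTwo ∧
      AsideStevensOptimalGamma1AtTwo) := Iff.rfl

/-- … hence inhabited from the four K4 items (19567 contributes its first conjunct only). -/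
theorem bundle_of_items (hPub : OrdPublishedInputsAtTwo) (hIso : OrdIsoPublishedInputsAtTwo)
    (hAU : AsideAbbesUllmoManinAtTwo) (hT2 : AsideStevensOptimalGamma1AtTwo) : OrdMLBPrintBundleAtTwo :=
  ⟨hPub, hIso.1, hAU, hT2⟩

/-- child dedup, unchanged at rev 29: the K4 crux child is S3's stmt-19556 verbatim. -/
theorem child_iff_S3 :
    Theses.ByReductionTypeAtTwo.OrdLambdaHalfAtTwo ↔ Theses.TwoAdicConverse.OrdLambdaHalfAtTwo := Iff.rfl

/-- the glue item stmt-23765 is closed in the TREE: the landed theorem p676269, by name. -/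
theorem glue_landed : OrdMissingLowerBoundAtTwoOfChildren :=
  Theorems.KatoFreeSandwich.ordMissingLowerBoundAtTwoOfChildren_proof

/-- crux 203 (stmt-19577) on the READY route rev 29: from K4's own items 19149, 19567, 20090, 23771 and S3's 19556,
all BY NAME (conditional restatement; closes nothing). -/
theorem crux203_of_items (hPub : OrdPublishedInputsAtTwo) (hIso : OrdIsoPublishedInputsAtTwo)
    (hAU : AsideAbbesUllmoManinAtTwo) (hT2 : AsideStevensOptimalGamma1AtTwo)
    (hLam : Theses.TwoAdicConverse.OrdLambdaHalfAtTwo) : OrdMissingLowerBoundAtTwo :=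
  glue_landed (bundle_of_items hPub hIso hAU hT2) (child_iff_S3.mpr hLam)

end Summit.BirchSwinnertonDyer.BirchSwinnertonDyer.Cruxes.OrdMissingLowerBoundAtTwo.TriageR1Seat1.Rev29Ready
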